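import Summits.BirchSwinnertonDyer.BirchSwinnertonDyer.Theorems.RamifiedSevenEllipticUnitsKummerIndexCore
import Literature.NumberTheory.EllipticCurves.BurungaleKobayashiNakamuraOta2026.LocalBottomIndex
import Literature.NumberTheory.EllipticCurves.SelmerCorankProofs
import HarnessLib

/-!
# K7r crux `EllipticUnitValueSeven` (stmt-BirchSwinnertonDyer-19705), line `rubin-formula`, stub S_dict
# `stub_localMordellWeilDictSeven`: the local Mordell–Weil index exponent `m_loc` COMPUTED IN A CHART
# (instantiation of the abstract compact-Kummer index core at the tree's Kummer objects; cell `bsd-cm`,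
# seat `bsd-cm-k7r-c3` g6; helper file, `--supports` 19705)

HONEST FRAMING. Nothing is asserted about the crux; BSD is not proved by any of this; a closed item
closes a rung leaf of BirchSwinnertonDyer at most. This file connects
`RamifiedSevenEllipticUnitsKummerIndexCore.lean` (pure group theory) with the objects of
`Literature/…/BurungaleKobayashiNakamuraOta2026/LocalBottomIndex.lean` (seat k7r-c3 g5): for an
elliptic curve `W` over a perfect field `K`, a perfect `K`-field `E` (a completion), a `K`-embedding
`ι : K̄ → K̄_E`, and a CHART `Φ : E_E(E) → V` of the `E`-rational points of the local curve
`W_E = W.baseChange E` (additive, kernel = torsion, ONTO a torsion-free `p`-adically separated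
`ℤ_p`-module `V`), with `E_E(E)[p] = 0`:

  `[E(L·E) ⊗ ℤ_p : tors + loc_ι(E(L) ⊗ ℤ_p)]` (the relative index of `HasLocalMordellWeilIndexExpOfEmb ι p ⊤`)
    `= [V : ℤ_p · Φ(E(K))]`     (`relIndex_localKummer_eq_index_span_chart`),

where `E(K) ↪ E_E(E)` by base change. Ingredients (all in the tree): Galois descent
`E_E(K̄_E)^{Γ_E} = E_E(E)` (`exists_toGeomPoints_eq_of_forall_smul_eq`), the compact Kummer map
`kummerFamilyHom` with level-`k` kernel `p^k E_E(E)` (Part 7), `kummerSpan_eq_closure_kummerFamily`,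
the transport of Kummer families under `loc_ι` (`IsKummerFamilyOver.localTorsionResPi`, Part 5), and the
core theorem `KummerCore.relIndex_torsion_sup_kummerSpan_eq`. Consequently
`HasLocalMordellWeilIndexExpOfEmb ι p ⊤ m ↔ [V : ℤ_p · Φ(E(K))] = p^m`
(`hasLocalMordellWeilIndexExpOfEmb_top_iff_index`). References: B. Perrin-Riou, Bull. SMF 115 (1987) §0;
J. H. Silverman, *AEC* (2009) VIII.§1–2; cell memo `STUB-PLAN-stub_localMordellWeilDictSeven.md`.
-/

set_option linter.dupNamespace false

noncomputable section

open scoped Classical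

open WeierstrassCurve Literature.NumberTheory.EllipticCurves

universe u

namespace Summit.BirchSwinnertonDyer.BirchSwinnertonDyer.Theorems.RamifiedSevenEllipticUnits.KummerCore

variable {K : Type u} [Field K] (W : WeierstrassCurve K) {E : Type u} [Field E] [Algebra K E]
  (ι : AlgebraicClosure K →ₐ[K] AlgebraicClosure E)

/-! ## §1 Points: `E(K) → E_E(E) → E_E(K̄_E)` and the embedding `ι` -/

/-- `ι_* ∘ (E(K) ↪ E(K̄)) = (E(K) ↪ E(K̄_E))` on points (`Affine.Point.map_baseChange`).
[cite: SilvermanAEC2009, VIII.§1 (points over extensions)] -/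
theorem pointsMapOfEmb_toGeomPoints (R : W.toAffine.Point) :
    pointsMapOfEmb W ι (toGeomPoints W R) =
      Affine.Point.baseChange (W' := W) K (AlgebraicClosure E) R := by
  unfold pointsMapOfEmb toGeomPoints
  exact Affine.Point.map_baseChange (W' := W) ι R

/-- **`ι_*` of a `K`-rational point is the `E`-rational point it defines**:
`geomPointsMapOfEmb ι (toGeomPoints W R) = toGeomPoints (W_E) (R_E)`, `R_E` the base change of `R` to `E`.
[cite: SilvermanAEC2009, VIII.§1 (points over extensions)] -/
theorem geomPointsMapOfEmb_toGeomPoints (R : W.toAffine.Point) :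
    W.geomPointsMapOfEmb ι (toGeomPoints W R) =
      toGeomPoints (W.baseChange E) (Affine.Point.baseChange (W' := W) K E R) := by
  rw [geomPointsMapOfEmb_apply, pointsMapOfEmb_toGeomPoints]
  rcases R with _ | ⟨x, y, h⟩
  · rfl
  · rfl

/-- The local subgroup of `⊤` is `⊤` (`H = Γ_K` gives `H_E = Γ_E`). [cite: SerreGaloisCohomology1997, II.§1.1] -/
theorem localSubgroupOfEmb_top :
    localSubgroupOfEmb (⊤ : Subgroup (Field.absoluteGaloisGroup K)) ι = ⊤ := by
  rw [localSubgroupOfEmb, Subgroup.comap_top]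

/-- `E`-rational points of `W_E` are fixed by the local subgroup. [cite: SilvermanAEC2009, VIII.§1 (`E(L) = E(K̄)^{Gal(K̄/L)}`)] -/
theorem toGeomPoints_mem_fixedGeomPoints (H' : Subgroup (Field.absoluteGaloisGroup E))
    (R : (W.baseChange E).toAffine.Point) :
    toGeomPoints (W.baseChange E) R ∈ (W.baseChange E).fixedGeomPoints H' :=
  ((W.baseChange E).mem_fixedGeomPoints_iff _).2 fun σ _ ↦ smul_toGeomPoints _ σ R

/-- **Galois descent at the place `ι`**: a point of `E_E(K̄_E)` fixed by `H_E` for `H = Γ_K` (so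
`H_E = Γ_E`) is `E`-rational (`E` perfect). [cite: SilvermanAEC2009, VIII.§1 (proof of Prop. 1.2)] -/
theorem exists_toGeomPoints_eq_of_mem_fixedGeomPoints_top [PerfectField E]
    {P : geomPoints (W.baseChange E)}
    (hP : P ∈ (W.baseChange E).fixedGeomPoints (localSubgroupOfEmb ⊤ ι)) :
    ∃ R : (W.baseChange E).toAffine.Point, toGeomPoints (W.baseChange E) R = P :=
  exists_toGeomPoints_eq_of_forall_smul_eq _ fun σ ↦
    ((W.baseChange E).mem_fixedGeomPoints_iff P).1 hP σ (by rw [localSubgroupOfEmb_top]; trivial)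

/-- Galois descent over `K`: the `Γ_K`-fixed points of `E(K̄)` are the `K`-rational points (`K` perfect).
[cite: SilvermanAEC2009, VIII.§1 (proof of Prop. 1.2)] -/
theorem exists_toGeomPoints_eq_of_mem_fixedGeomPoints_top' [PerfectField K] {Q : geomPoints W}
    (hQ : Q ∈ W.fixedGeomPoints ⊤) : ∃ R : W.toAffine.Point, toGeomPoints W R = Q :=
  exists_toGeomPoints_eq_of_forall_smul_eq _ fun σ ↦ (W.mem_fixedGeomPoints_iff Q).1 hQ σ trivial

/-! ## §2 The two Kummer spans as spans of Kummer families of points -/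

variable (p : ℕ) [Fact p.Prime]

/-- The `ℤ_p`-action `padicPi` acts on the `k`-th component through `c mod p^k ∈ ℕ ⊆ ℤ`. [cite: PerrinRiou1987BSMF, §0 p. 401] -/
theorem padicPi_apply_eq {F : Type u} [Field F] (V : WeierstrassCurve F)
    (H' : Subgroup (Field.absoluteGaloisGroup F)) (c : ℤ_[p]) (x : V.torsionH1Pi p H') (k : ℕ) :
    V.padicPi p H' c x k = ((PadicInt.toZModPow k c).val : ℤ) • x k := by
  simp [padicPi]

/-- **(Y) as a span of Kummer families**: the local Kummer compact group `E(L·E) ⊗ ℤ_p` is the subgroup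
generated by the `c · κ(P)`, `P` an `H_E`-fixed point, `κ = kummerFamilyHom`
(`kummerSpan_eq_closure_kummerFamily`). [cite: BlochKato1990, Example 3.11] [cite: Howard2004HeegnerKolyvagin, §1 (descent sequence for S_p(E/L))] -/
theorem localKummerCompactOfEmb_eq_closure [W.IsElliptic] (H : Subgroup (Field.absoluteGaloisGroup K)) :
    W.localKummerCompactOfEmb ι p H =
      AddSubgroup.closure {x | ∃ (P : (W.baseChange E).fixedGeomPoints (localSubgroupOfEmb H ι))
        (c : ℤ_[p]), x = (W.baseChange E).padicPi p (localSubgroupOfEmb H ι) c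
          ((W.baseChange E).kummerFamilyHom p (localSubgroupOfEmb H ι) P)} := by
  unfold localKummerCompactOfEmb mordellWeilKummerSpan
  rw [kummerSpan_eq_closure_kummerFamily]
  congr 1
  ext x
  constructor
  · rintro ⟨P, hPS, c, rfl⟩
    exact ⟨⟨P, hPS⟩, c, rfl⟩
  · rintro ⟨P, c, rfl⟩
    exact ⟨P, P.2, c, rfl⟩

/-- **`loc_ι(E(L) ⊗ ℤ_p)` as a span of local Kummer families**: for `H = Γ_K` (`L = K`), the localisation
of the global Mordell–Weil Kummer span is the subgroup generated by the `c · κ(P)` with `P` running over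
the `H_E`-fixed local points COMING FROM `E(K)` (`ι_*` of a `K`-rational point; Kummer families localise
to Kummer families, `IsKummerFamilyOver.localTorsionResPi`; Galois descent over `K`).
[cite: Howard2004HeegnerKolyvagin, §1 (descent sequence for S_p(E/L))] [cite: SilvermanAEC2009, VIII.§1–2] -/
theorem map_localTorsionResPi_mordellWeilKummerSpan_top_eq_closure [W.IsElliptic] [PerfectField K] :
    (W.mordellWeilKummerSpan p ⊤).map (W.localTorsionResPi ι p ⊤) =
      AddSubgroup.closure {x | ∃ P ∈ {P : (W.baseChange E).fixedGeomPoints (localSubgroupOfEmb ⊤ ι) |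
          ∃ R : W.toAffine.Point, (P : geomPoints (W.baseChange E)) =
            W.geomPointsMapOfEmb ι (toGeomPoints W R)},
        ∃ c : ℤ_[p], x = (W.baseChange E).padicPi p (localSubgroupOfEmb ⊤ ι) c
          ((W.baseChange E).kummerFamilyHom p (localSubgroupOfEmb ⊤ ι) P)} := by
  unfold mordellWeilKummerSpan
  rw [kummerSpan_eq_closure_kummerFamily, AddMonoidHom.map_closure]
  congr 1
  ext x
  constructor
  · rintro ⟨y, ⟨Q, hQS, c, rfl⟩, rfl⟩
    obtain ⟨R, hR⟩ := exists_toGeomPoints_eq_of_mem_fixedGeomPoints_top' W hQS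
    have hfix : ∀ σ ∈ (⊤ : Subgroup (Field.absoluteGaloisGroup K)), σ • Q = Q :=
      (W.mem_fixedGeomPoints_iff Q).1 hQS
    refine ⟨⟨W.geomPointsMapOfEmb ι Q, ((W.baseChange E).mem_fixedGeomPoints_iff _).2
      (W.smul_geomPointsMapOfEmb_of_fixed ι ⊤ hfix)⟩, ⟨R, by rw [hR]⟩, c, ?_⟩
    rw [localTorsionResPi_padicPi, kummerFamilyHom_apply,
      ← IsKummerFamilyOver.eq_kummerFamily p (W.smul_geomPointsMapOfEmb_of_fixed ι ⊤ hfix)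
        (IsKummerFamilyOver.localTorsionResPi W ι p ⊤ hfix
          (W.isKummerFamilyOver_kummerFamily p ⊤ ⟨Q, hQS⟩))]
  · rintro ⟨P, ⟨R, hPR⟩, c, rfl⟩
    have hQS : toGeomPoints W R ∈ W.fixedGeomPoints ⊤ :=
      (W.mem_fixedGeomPoints_iff _).2 fun σ _ ↦ smul_toGeomPoints W σ R
    have hfix : ∀ σ ∈ (⊤ : Subgroup (Field.absoluteGaloisGroup K)), σ • toGeomPoints W R =
        toGeomPoints W R := (W.mem_fixedGeomPoints_iff _).1 hQS
    refine ⟨W.padicPi p ⊤ c (W.kummerFamily p ⊤ ⟨toGeomPoints W R, hQS⟩), ⟨_, hQS, c, rfl⟩, ?_⟩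
    rw [localTorsionResPi_padicPi, kummerFamilyHom_apply]
    congr 1
    have hP : P = ⟨W.geomPointsMapOfEmb ι (toGeomPoints W R),
        ((W.baseChange E).mem_fixedGeomPoints_iff _).2
          (W.smul_geomPointsMapOfEmb_of_fixed ι ⊤ hfix)⟩ := Subtype.ext hPR
    rw [hP]
    exact IsKummerFamilyOver.eq_kummerFamily p (W.smul_geomPointsMapOfEmb_of_fixed ι ⊤ hfix)
      (IsKummerFamilyOver.localTorsionResPi W ι p ⊤ hfix
        (W.isKummerFamilyOver_kummerFamily p ⊤ ⟨toGeomPoints W R, hQS⟩))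

/-! ## §3 The local Mordell–Weil index in a chart -/

/-- **THE LOCAL MORDELL–WEIL INDEX IN A CHART.** `W` elliptic over a perfect field `K`, `E` a perfect
`K`-field, `ι : K̄ → K̄_E` a `K`-embedding; `Φ : E_E(E) → V` an additive chart of the `E`-rational
points of `W_E` with kernel the torsion, ONTO a `ℤ_p`-module `V` which is torsion-free and `p`-adically
separated; no point of order `p` in `E_E(E)`. Then the relative index of
`HasLocalMordellWeilIndexExpOfEmb ι p ⊤` (`[E(L·E) ⊗ ℤ_p : tors + loc_ι(E(K) ⊗ ℤ_p)]`, `L = K`) equals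
`[V : ℤ_p · Φ(E(K))]`, the index of the `ℤ_p`-span of the chart values of the `K`-rational points.
Proof: the core theorem `relIndex_torsion_sup_kummerSpan_eq` at `M = E_E(E)` (≅ the `H_E`-fixed points by
Galois descent), `κ = kummerFamilyHom`, `act = padicPi`, `G = ⊤`, `M₀ =` the image of `E(K)`; §2 rewrites
both tree spans as the core's closures. [cite: PerrinRiou1987BSMF, §0 p. 401]
[cite: SilvermanAEC2009, VIII.§1–2 and Prop. VII.6.3] -/
theorem relIndex_localKummer_eq_index_span_chart [W.IsElliptic] [PerfectField K] [PerfectField E]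
    {V : Type*} [AddCommGroup V] [Module ℤ_[p] V] [NoZeroSMulDivisors ℤ_[p] V]
    (Φ : (W.baseChange E).toAffine.Point →+ V) (hΦ : ∀ x, Φ x = 0 ↔ IsOfFinAddOrder x)
    (hΦs : Function.Surjective Φ)
    (hsep : ∀ v : V, (∀ k : ℕ, ∃ w : V, ((p : ℤ_[p]) ^ k) • w = v) → v = 0)
    (hE : ∀ x : (W.baseChange E).toAffine.Point, p • x = 0 → x = 0) :
    (AddCommGroup.torsion ((W.baseChange E).torsionH1Pi p (localSubgroupOfEmb ⊤ ι)) ⊔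
        (W.mordellWeilKummerSpan p ⊤).map (W.localTorsionResPi ι p ⊤)).relIndex
      (W.localKummerCompactOfEmb ι p ⊤) =
    (Submodule.span ℤ_[p]
      (Φ '' Set.range (Affine.Point.baseChange (W' := W) K E))).toAddSubgroup.index := by
  -- the descent isomorphism `E_E(E) ≃ fixed points`
  set j : (W.baseChange E).toAffine.Point →+ (W.baseChange E).fixedGeomPoints (localSubgroupOfEmb ⊤ ι) :=
    (toGeomPoints (W.baseChange E)).codRestrict _
      (toGeomPoints_mem_fixedGeomPoints W (localSubgroupOfEmb ⊤ ι)) with hj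
  have hjval : ∀ R, ((j R : (W.baseChange E).fixedGeomPoints (localSubgroupOfEmb ⊤ ι)) :
      geomPoints (W.baseChange E)) = toGeomPoints (W.baseChange E) R := fun _ ↦ rfl
  have hjbij : Function.Bijective j := by
    refine ⟨fun R R' h ↦ toGeomPoints_injective (W.baseChange E) (by rw [← hjval, ← hjval, h]),
      fun P ↦ ?_⟩
    obtain ⟨R, hR⟩ := exists_toGeomPoints_eq_of_mem_fixedGeomPoints_top W ι P.2
    exact ⟨R, Subtype.ext (by rw [hjval, hR])⟩
  set e : (W.baseChange E).toAffine.Point ≃+ (W.baseChange E).fixedGeomPoints (localSubgroupOfEmb ⊤ ι) :=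
    AddEquiv.ofBijective j hjbij with he
  have heval : ∀ R, ((e R : (W.baseChange E).fixedGeomPoints (localSubgroupOfEmb ⊤ ι)) :
      geomPoints (W.baseChange E)) = toGeomPoints (W.baseChange E) R := fun _ ↦ rfl
  -- the chart on the fixed points
  set Ψ : (W.baseChange E).fixedGeomPoints (localSubgroupOfEmb ⊤ ι) →+ V :=
    Φ.comp e.symm.toAddMonoidHom with hΨ
  have hΨe : ∀ R, Ψ (e R) = Φ R := fun R ↦ by
    rw [hΨ, AddMonoidHom.coe_comp, Function.comp_apply, AddEquiv.coe_toAddMonoidHom,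
      AddEquiv.symm_apply_apply]
  have hΨ0 : ∀ P, Ψ P = 0 ↔ IsOfFinAddOrder P := fun P ↦ by
    obtain ⟨R, rfl⟩ := e.surjective P
    rw [hΨe, hΦ]
    exact (Function.Injective.isOfFinAddOrder_iff (f := e.toAddMonoidHom) e.injective).symm
  have hG : ∀ v : V, v ∈ (⊤ : Submodule ℤ_[p] V) ↔
      ∃ P : (W.baseChange E).fixedGeomPoints (localSubgroupOfEmb ⊤ ι), Ψ P = v := fun v ↦
    ⟨fun _ ↦ by obtain ⟨R, hR⟩ := hΦs v; exact ⟨e R, by rw [hΨe, hR]⟩, fun _ ↦ Submodule.mem_top⟩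
  have hM : ∀ P : (W.baseChange E).fixedGeomPoints (localSubgroupOfEmb ⊤ ι), p • P = 0 → P = 0 := by
    intro P hP
    obtain ⟨R, rfl⟩ := e.surjective P
    rw [← map_nsmul, e.map_eq_zero_iff] at hP
    rw [hE R hP, map_zero]
  -- the core theorem at `M₀ =` the image of `E(K)`
  have core := relIndex_torsion_sup_kummerSpan_eq
    ((W.baseChange E).kummerFamilyHom p (localSubgroupOfEmb ⊤ ι))
    ((W.baseChange E).padicPi p (localSubgroupOfEmb ⊤ ι)) Ψ ⊤ hM
    (fun P k ↦ by
      rw [kummerFamilyHom_apply]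
      exact (W.baseChange E).kummerFamily_apply_eq_zero_iff p (localSubgroupOfEmb ⊤ ι) P k)
    (fun c x k ↦ padicPi_apply_eq p (W.baseChange E) (localSubgroupOfEmb ⊤ ι) c x k) hΨ0 hG hsep
    {P : (W.baseChange E).fixedGeomPoints (localSubgroupOfEmb ⊤ ι) |
      ∃ R : W.toAffine.Point, (P : geomPoints (W.baseChange E)) =
        W.geomPointsMapOfEmb ι (toGeomPoints W R)}
  rw [localKummerCompactOfEmb_eq_closure, map_localTorsionResPi_mordellWeilKummerSpan_top_eq_closure,
    core, Submodule.top_toAddSubgroup, AddSubgroup.relIndex_top_right]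
  -- the chart values of the image of `E(K)`
  congr 3
  ext v
  constructor
  · rintro ⟨P, ⟨R, hPR⟩, rfl⟩
    have hP : P = e (Affine.Point.baseChange (W' := W) K E R) :=
      Subtype.ext (by rw [hPR, heval, geomPointsMapOfEmb_toGeomPoints])
    exact ⟨_, ⟨R, rfl⟩, by rw [hP, hΨe]⟩
  · rintro ⟨_, ⟨R, rfl⟩, rfl⟩
    exact ⟨e (Affine.Point.baseChange (W' := W) K E R),
      ⟨R, by rw [heval, geomPointsMapOfEmb_toGeomPoints]⟩, hΨe _⟩

/-- **`m_loc` in a chart**: under the same hypotheses, `HasLocalMordellWeilIndexExpOfEmb ι p ⊤ m` (the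
tree's `p^m = [E(L·E) ⊗ ℤ_p : tors + loc_ι(E(K) ⊗ ℤ_p)]`) holds iff `[V : ℤ_p · Φ(E(K))] = p^m`.
[cite: PerrinRiou1987BSMF, §0 p. 401] [cite: SilvermanAEC2009, VIII.§1–2 and Prop. VII.6.3] -/
theorem hasLocalMordellWeilIndexExpOfEmb_top_iff_index [W.IsElliptic] [PerfectField K] [PerfectField E]
    {V : Type*} [AddCommGroup V] [Module ℤ_[p] V] [NoZeroSMulDivisors ℤ_[p] V]
    (Φ : (W.baseChange E).toAffine.Point →+ V) (hΦ : ∀ x, Φ x = 0 ↔ IsOfFinAddOrder x)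
    (hΦs : Function.Surjective Φ)
    (hsep : ∀ v : V, (∀ k : ℕ, ∃ w : V, ((p : ℤ_[p]) ^ k) • w = v) → v = 0)
    (hE : ∀ x : (W.baseChange E).toAffine.Point, p • x = 0 → x = 0) (m : ℕ) :
    W.HasLocalMordellWeilIndexExpOfEmb ι p ⊤ m ↔
      (Submodule.span ℤ_[p]
        (Φ '' Set.range (Affine.Point.baseChange (W' := W) K E))).toAddSubgroup.index = p ^ m := by
  unfold HasLocalMordellWeilIndexExpOfEmb
  rw [relIndex_localKummer_eq_index_span_chart W ι p Φ hΦ hΦs hsep hE]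

end Summit.BirchSwinnertonDyer.BirchSwinnertonDyer.Theorems.RamifiedSevenEllipticUnits.KummerCore

end
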